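import Mathlib

/-!
# Route `FilamentSkeletonRss` · crux `TransverseReduction1AG` (stmt-NavierStokesRegularity-27853; A1L twin stmt-23297) · line
# `defect_column_gate_1AG/1AL` — PRELIMINARIES for the azimuthal blocks `|m| ≥ 3` of the localised sectional waist gate
# `WaistColumnGateLoc1A` (stub S2a-loc): a first-order maximum principle and the symbol inequality

Helper file (`--supports stmt-NavierStokesRegularity-27853 --as helper`; seat ns-filament-s2aloc-p1 g2, MINT req187 no-hit branch).  First of
two files (this, `…AzimuthalBlock.lean`).  Contents: §1 `maxPrinciple_of_wronskian` — a one-variable maximum principle that only needs the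
SIGN of the derivative of a Wronskian-type flux `Wr = P·v′` (`P > 0`) at interior critical points of `v` above a threshold (so second
derivatives of the unknowns never appear: in the application `Wr` is built from the fluxes `4u a′ + γu a`, `4u b′ + γu b` of the block);
§2 the cubic certificate `7x³ − 210x² + 1183x + 12168 ≥ 0` (`x ≥ 0`) and the resulting symbol lower bound
`γu(u+κ)²/8 ≤ m²(u+κ)² + γu³ − 32u² + κ(8 − γκ)u` for `κ = 13/γ`, `m² ≥ 9`, which says that `(u + 13/γ)^{−4}` is a global strict
supersolution of the modulus operator of the azimuthal block (see the second file for the dictionary and the estimate).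
HONEST FRAMING: elementary real analysis serving ONE family of blocks of ONE linear MODEL operator of a hypothetical blow-up route (MODEL
rung, negative side); `WaistColumnGateLoc1A`, `TransverseReduction1AG/1AL` are neither proved nor refuted here; nothing in this file bears on
Navier–Stokes regularity.
-/

set_option linter.dupNamespace false

noncomputable section

namespace Summit.NavierStokesRegularity.NavierStokesRegularity.Theorems.DefectColumnGate

open scoped Topology
open Set Filter

/-! ## 1. A first-order maximum principle: no interior maximum above the threshold where the Wronskian flux increases -/

/-- **Maximum principle from the sign of a Wronskian-type flux at critical points.**  `v` continuous on `[α, β]` with derivative `v₁`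
on `(α, β)`; `Wr = P·v₁` with `P > 0` on `(α, β)`; at every interior point where `v > K` and `v₁ = 0` the flux `Wr` has a STRICTLY
positive derivative; `v ≤ K` at both ends.  Then `v ≤ K` on `[α, β]`.  (At an interior maximum `ξ` above `K` one would have `Wr(ξ) = 0`
with `Wr′(ξ) > 0`, hence `Wr < 0`, i.e. `v′ < 0`, immediately to the left of `ξ`, so `v > v(ξ)` there — a contradiction.) -/
theorem maxPrinciple_of_wronskian {α β K : ℝ} {v v₁ Wr P : ℝ → ℝ} (hαβ : α ≤ β)
    (hv : ContinuousOn v (Icc α β))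
    (hder : ∀ u ∈ Ioo α β, HasDerivAt v (v₁ u) u)
    (hWr : ∀ u ∈ Ioo α β, Wr u = P u * v₁ u)
    (hP : ∀ u ∈ Ioo α β, 0 < P u)
    (hcrit : ∀ u ∈ Ioo α β, K < v u → v₁ u = 0 → ∃ D : ℝ, 0 < D ∧ HasDerivAt Wr D u)
    (hα : v α ≤ K) (hβ : v β ≤ K) :
    ∀ u ∈ Icc α β, v u ≤ K := by
  obtain ⟨ξ, hξ, hmax⟩ :=
    (isCompact_Icc : IsCompact (Icc α β)).exists_isMaxOn (nonempty_Icc.2 hαβ) hv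
  intro u hu
  by_contra hcon
  have hcon' : K < v u := not_le.mp hcon
  have hξK : K < v ξ := lt_of_lt_of_le hcon' (hmax hu)
  -- the maximum point is interior
  have hξα : α < ξ := lt_of_le_of_ne hξ.1 (fun h => by subst h; exact absurd hα (not_le.mpr hξK))
  have hξβ : ξ < β := lt_of_le_of_ne hξ.2 (fun h => by subst h; exact absurd hβ (not_le.mpr hξK))
  have hξoo : ξ ∈ Ioo α β := ⟨hξα, hξβ⟩
  -- first-order condition
  have hloc : IsLocalMax v ξ := hmax.isLocalMax (Icc_mem_nhds hξα hξβ)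
  have hv₁ξ : v₁ ξ = 0 := hloc.hasDerivAt_eq_zero (hder ξ hξoo)
  have hWrξ : Wr ξ = 0 := by rw [hWr ξ hξoo, hv₁ξ, mul_zero]
  obtain ⟨D, hD, hWrD⟩ := hcrit ξ hξoo hξK hv₁ξ
  -- `Wr < 0` immediately to the left of `ξ`
  have ht : Tendsto (slope Wr ξ) (𝓝[<] ξ) (𝓝 D) :=
    (hasDerivAt_iff_tendsto_slope.mp hWrD).mono_left (nhdsLT_le_nhdsNE ξ)
  have hev : ∀ᶠ c in 𝓝[<] ξ, 0 < slope Wr ξ c := ht.eventually_const_lt hD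
  obtain ⟨l, hl, hlsub⟩ := mem_nhdsLT_iff_exists_Ioo_subset.mp hev
  have hneg : ∀ c ∈ Ioo l ξ, c ∈ Ioo α β → v₁ c < 0 := by
    intro c hc hcαβ
    have h1 : 0 < slope Wr ξ c := hlsub hc
    rw [slope_def_field, hWrξ, sub_zero] at h1
    have h2 : c - ξ < 0 := by linarith [hc.2]
    have h3 : Wr c < 0 := by
      by_contra h4
      have h4' : 0 ≤ Wr c := not_lt.mp h4
      have : Wr c / (c - ξ) ≤ 0 := div_nonpos_of_nonneg_of_nonpos h4' h2.le
      linarith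
    rw [hWr c hcαβ] at h3
    by_contra h5
    have h5' : 0 ≤ v₁ c := not_lt.mp h5
    have : 0 ≤ P c * v₁ c := mul_nonneg (hP c hcαβ).le h5'
    linarith
  -- a point `u₁` to the left of `ξ`, inside `(α, β)` and inside `(l, ξ)`
  set u₁ : ℝ := (max l α + ξ) / 2 with hu₁def
  have hmax_lt : max l α < ξ := max_lt (mem_Iio.mp hl) hξα
  have hu₁l : l < u₁ := by
    have := le_max_left l α
    rw [hu₁def]; linarith
  have hu₁α : α < u₁ := by
    have := le_max_right l α
    rw [hu₁def]; linarith
  have hu₁ξ : u₁ < ξ := by rw [hu₁def]; linarith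
  -- mean value theorem on `[u₁, ξ]`
  have hcont : ContinuousOn v (Icc u₁ ξ) := hv.mono (Icc_subset_Icc hu₁α.le hξβ.le)
  have hdiff : ∀ x ∈ Ioo u₁ ξ, HasDerivAt v (v₁ x) x :=
    fun x hx => hder x ⟨lt_trans hu₁α hx.1, lt_trans hx.2 hξβ⟩
  obtain ⟨c, hc, hcslope⟩ := exists_hasDerivAt_eq_slope v v₁ hu₁ξ hcont hdiff
  have hcneg : v₁ c < 0 :=
    hneg c ⟨lt_trans hu₁l hc.1, hc.2⟩ ⟨lt_trans hu₁α hc.1, lt_trans hc.2 hξβ⟩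
  rw [hcslope] at hcneg
  have hlt : v ξ < v u₁ := by
    have hpos : 0 < ξ - u₁ := by linarith
    have := (div_neg_iff.mp hcneg)
    rcases this with ⟨h1, _⟩ | ⟨h1, h2⟩
    · linarith
    · linarith
  have hle : v u₁ ≤ v ξ := hmax ⟨hu₁α.le, (lt_trans hu₁ξ hξβ).le⟩
  linarith

/-! ## 2. The symbol inequality: `(u + 13/γ)^{-4}` is a global strict supersolution of the modulus operator for `m² ≥ 9` -/

/-- The cubic certificate: `7x³ − 210x² + 1183x + 12168 ≥ 0` for `x ≥ 0` (`= 7x(x − 15)² − 392x + 12168`; for `x ≥ 31` use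
`7(x−15)² ≥ 392`). -/
theorem azimuthalBlock_cubic_nonneg {x : ℝ} (hx : 0 ≤ x) :
    0 ≤ 7 * x ^ 3 - 210 * x ^ 2 + 1183 * x + 12168 := by
  have key : 7 * x ^ 3 - 210 * x ^ 2 + 1183 * x + 12168 = 7 * x * (x - 15) ^ 2 - 392 * x + 12168 := by ring
  rw [key]
  rcases le_or_gt x 31 with h | h
  · nlinarith [mul_nonneg hx (sq_nonneg (x - 15))]
  · have h1 : 392 ≤ 7 * (x - 15) ^ 2 := by nlinarith
    nlinarith [mul_le_mul_of_nonneg_left h1 hx]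

/-- **The symbol lower bound.**  For `γ > 0`, `κ = 13/γ`, `m² ≥ 9` and `u ≥ 0`:
`γ u (u+κ)²/8 ≤ m²(u+κ)² + γu³ − 32u² + κ(8 − γκ)u`.  (Multiply by `8γ²`: the difference is
`8(m² − 9)(γu + 13)² + (7x³ − 210x² + 1183x + 12168)` with `x = γu`.) -/
theorem azimuthalBlock_symbol_lower {γ m u : ℝ} (hγ : 0 < γ) (hm : 9 ≤ m ^ 2) (hu : 0 ≤ u) :
    γ * u * (u + 13 / γ) ^ 2 / 8
      ≤ m ^ 2 * (u + 13 / γ) ^ 2 + γ * u ^ 3 - 32 * u ^ 2 + 13 / γ * (8 - γ * (13 / γ)) * u := by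
  have hγ0 : γ ≠ 0 := hγ.ne'
  have hx : 0 ≤ γ * u := mul_nonneg hγ.le hu
  have hcub := azimuthalBlock_cubic_nonneg hx
  have hm9 : 0 ≤ 8 * (m ^ 2 - 9) * (γ * u + 13) ^ 2 := by
    have : 0 ≤ m ^ 2 - 9 := by linarith
    positivity
  have key : m ^ 2 * (u + 13 / γ) ^ 2 + γ * u ^ 3 - 32 * u ^ 2 + 13 / γ * (8 - γ * (13 / γ)) * u
      - γ * u * (u + 13 / γ) ^ 2 / 8
      = (8 * (m ^ 2 - 9) * (γ * u + 13) ^ 2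
          + (7 * (γ * u) ^ 3 - 210 * (γ * u) ^ 2 + 1183 * (γ * u) + 12168)) / (8 * γ ^ 2) := by
    field_simp
    ring
  have hnum : 0 ≤ (8 * (m ^ 2 - 9) * (γ * u + 13) ^ 2
          + (7 * (γ * u) ^ 3 - 210 * (γ * u) ^ 2 + 1183 * (γ * u) + 12168)) / (8 * γ ^ 2) := by
    apply div_nonneg (by linarith) (by positivity)
  linarith [key, hnum]

end Summit.NavierStokesRegularity.NavierStokesRegularity.Theorems.DefectColumnGate

end
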